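import Literature.MathematicalPhysics.QuantumFieldTheory.OSLogSlotAnalyticity
import Literature.Analysis.Complex.FlatTubeFourierFamily
import HarnessLib

/-!
# The logarithmic-slot engine with explicit extension and explicit bounds

Topic `Literature/MathematicalPhysics/QuantumFieldTheory`; supplement to `OSLogSlotAnalyticity` (the
generic Osterwalder–Schrader Ch. V engine: joint analyticity in the logarithmic variables from
holomorphic slots). The tree's `LogSlot.exists_holomorphic_extension_logDensity` produces the
holomorphic extension `F` of `x ↦ e^{-2b∑xᵢ²} S(eˣ)` existentially, with an existential bound on
each closed sub-tube. For the removal of the regularisation in Osterwalder–Schrader II, Ch. VI.1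
(through `Literature.Analysis.Complex.exists_holomorphic_density_of_scaled_regularisations`) the
bound must be tracked as a function of the slot constants — it is what carries the E0' growth of
the regularising profiles. This file re-runs the engine on the explicit form of the flat tube theorem
(`Literature.Analysis.Complex.l1TubeExtension_spec`):

* `LogSlot.slotBmax` — the maximum over the slots of the slot bounds at Gaussian profiles, an
  explicit (integral) expression, linear in the slot constants `Cᵢ`;
* `LogSlot.l1TubeExtension_logT_spec` — for the explicit extension
  `F = l1TubeExtension b (logT S b)`: holomorphy on `{∑ |Im zᵢ| < π/2}`, the **explicit bound**
  `‖F z‖ ≤ l1TubeBound (π/2) b 0 (k+1) (fun _ => slotBmax) (fun _ => 0) c` on `{∑ |Im zᵢ| ≤ c}`, the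
  representation of `logT`, continuity of the Fourier data, and the **real-point identity**
  `F(x) = e^{-2b∑xᵢ²} S(eˣ)`.

## References

* K. Osterwalder, R. Schrader, *Axioms for Euclidean Green's functions II*, Comm. Math. Phys.
  42 (1975) 281–305, Ch. V pp. 291–292, (5.7)–(5.8); Ch. VI.1 p. 300. [OsterwalderSchraderCMP1975]
-/

noncomputable section

open MeasureTheory Set Filter Real
open _root_.Topology
open scoped NNReal SchwartzMap ContDiff

namespace Literature.MathematicalPhysics.QuantumFieldTheory.LogSlot

open Literature.Analysis.Complex

section Explicit

variable {k : ℕ} (S : (Fin (k + 1) → ℝ) → ℂ) (E : Fin (k + 1) → (Fin k → ℝ) → ℂ → ℂ) {b : ℝ} (hb : 0 < b)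
  (hSc : Continuous S) {C₀ : ℝ} {N₀ : ℕ} (hSb : ∀ u, ‖S u‖ ≤ C₀ * (1 + ‖u‖) ^ N₀)
  (hEc : ∀ i τ, Continuous fun u' => E i u' τ)
  (hEd : ∀ i u', DifferentiableOn ℂ (E i u') {τ : ℂ | 0 < τ.re})
  (C : Fin (k + 1) → ℝ) (N : Fin (k + 1) → ℕ) (hC : ∀ i, 0 ≤ C i)
  (hCN : ∀ i (u' : Fin k → ℝ) (τ : ℂ), 0 ≤ τ.re → ‖E i u' τ‖ ≤ C i * (1 + ‖u'‖) ^ N i)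
  (hES : ∀ i (u' : Fin k → ℝ), (∀ j, 0 ≤ u' j) → ∀ x : ℝ, 0 ≤ x → E i u' x = S (i.insertNth x u'))

/-- **The maximal slot bound at Gaussian profiles**, an explicit expression in the slot constants
`Cᵢ, Nᵢ` and the window `b` (the frequencies of the modulated Gaussians drop out,
`slotB_gaussMod_eq`). [folklore] -/
def slotBmax (b : ℝ) (C : Fin (k + 1) → ℝ) (N : Fin (k + 1) → ℕ) : ℝ :=
  (Finset.univ : Finset (Fin (k + 1))).sup' Finset.univ_nonempty fun i =>
    slotB i b (C i) (N i) fun _ (s : ℝ) => Complex.exp (-(b : ℂ) * (s : ℂ) ^ 2)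

include hb hSc hSb hEc hEd hC hCN hES

/-- **The logarithmic-slot engine, explicit form.** Under the hypotheses of
`exists_holomorphic_extension_logDensity` with *given* slot constants `Cᵢ ≥ 0`, `Nᵢ`
(`‖Eᵢ(u', τ)‖ ≤ Cᵢ (1 + ‖u'‖)^{Nᵢ}` on `Re τ ≥ 0`), the explicit extension
`F = l1TubeExtension b (logT S b)` is holomorphic on `{∑ⱼ |Im zⱼ| < π/2}`, obeys the explicit bound
`‖F z‖ ≤ l1TubeBound (π/2) b 0 (k+1) (fun _ => slotBmax b C N) (fun _ => 0) c` on `{∑ⱼ |Im zⱼ| ≤ c}`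
(`c < π/2`), represents the functional (`logT S b (e^{-b·²}ϑ) = ∫ F(x) ∏ ϑⱼ(xⱼ) dx`), has continuous
Fourier data, and satisfies the real-point identity `F(x) = e^{-2b∑xⱼ²} S(eˣ)`. [cite: OsterwalderSchraderCMP1975, Ch. V eqs. (5.7)–(5.8)] -/
theorem l1TubeExtension_logT_spec :
    DifferentiableOn ℂ (l1TubeExtension b (logT S b)) {z : Fin (k + 1) → ℂ | ∑ j, |(z j).im| < π / 2} ∧
      (∀ c : ℝ, c < π / 2 → ∀ z : Fin (k + 1) → ℂ, ∑ j, |(z j).im| ≤ c →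
        ‖l1TubeExtension b (logT S b) z‖ ≤
          l1TubeBound (π / 2) b 0 (k + 1) (fun _ => slotBmax b C N) (fun _ => 0) c) ∧
      (∀ ϑ : Fin (k + 1) → 𝓢(ℝ, ℂ),
        logT S b (fun j (s : ℝ) => Complex.exp (-(b : ℂ) * (s : ℂ) ^ 2) * ϑ j s) =
          ∫ x : Fin (k + 1) → ℝ, l1TubeExtension b (logT S b) (fun j => (x j : ℂ)) * ∏ j, ϑ j (x j)) ∧
      (Continuous fun p : Fin (k + 1) → ℝ => logT S b (fun j (s : ℝ) =>
        Complex.exp (-(b : ℂ) * (s : ℂ) ^ 2) * Complex.exp (↑(-2 * π * s * p j) * Complex.I))) ∧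
      ∀ x : Fin (k + 1) → ℝ, l1TubeExtension b (logT S b) (fun j => (x j : ℂ)) = logDensity S b x := by
  -- the explicit flat tube theorem for `T = logT S b`
  have hspec := l1TubeExtension_spec (a := π / 2) (κ := 0) (by positivity) hb (logT S b)
    (fun i θ _ => slotB i b (C i) (N i) θ)
    (fun i θ => logT_slot S E hb hSc hSb hEc hEd hES i (hC i) (hCN i) θ)
    (fun _ => slotBmax b C N) (fun _ => 0)
    (fun c _ i p => by
      rw [slotB_gaussMod_eq, pow_zero, mul_one]
      exact Finset.le_sup' (fun i => slotB i b (C i) (N i) fun _ (s : ℝ) =>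
        Complex.exp (-(b : ℂ) * (s : ℂ) ^ 2)) (Finset.mem_univ i))
  obtain ⟨hF, hK, hT, hΦc, -⟩ := hspec
  refine ⟨hF, hK, hT, hΦc, fun x₀ => ?_⟩
  -- the real-point identity (as in `exists_holomorphic_extension_logDensity`, with `F` explicit)
  set F := l1TubeExtension b (logT S b) with hFdef
  set ι : (Fin (k + 1) → ℝ) → (Fin (k + 1) → ℂ) := fun x j => (x j : ℂ) with hι
  have hιc : Continuous ι := continuous_pi fun j => Complex.continuous_ofReal.comp (continuous_apply j)
  have hιmem : ∀ x, ι x ∈ {z : Fin (k + 1) → ℂ | ∑ j, |(z j).im| < π / 2} := fun x => by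
    simp only [hι, mem_setOf_eq, Complex.ofReal_im, abs_zero, Finset.sum_const_zero]
    positivity
  have hFc : Continuous fun x => F (ι x) := hF.continuousOn.comp_continuous hιc hιmem
  set K : ℝ := l1TubeBound (π / 2) b 0 (k + 1) (fun _ => slotBmax b C N) (fun _ => 0) 0 with hKdef
  have hFb : ∀ x, ‖F (ι x)‖ ≤ |K| * (1 + ‖x‖) ^ 0 := fun x => by
    rw [pow_zero, mul_one]
    refine (hK 0 (by positivity) _ ?_).trans (le_abs_self K)
    simp [hι]
  have hC0' : ∀ u, ‖S u‖ ≤ |C₀| * (1 + ‖u‖) ^ N₀ := fun u =>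
    (hSb u).trans (mul_le_mul_of_nonneg_right (le_abs_self _) (by positivity))
  have hDb : ∀ x, ‖logDensity S b x‖ ≤
      |C₀| * (2 : ℝ) ^ N₀ * Real.exp (((N₀ : ℝ)) ^ 2 / (4 * (2 * b))) * (1 + ‖x‖) ^ 0 := by
    intro x
    rw [pow_zero, mul_one, logDensity, norm_mul, Complex.norm_exp]
    have hre : (-(2 * b : ℂ) * ∑ i, (x i : ℂ) ^ 2).re = -(2 * b) * ∑ i, (x i) ^ 2 := by
      have : (-(2 * b : ℂ) * ∑ i, (x i : ℂ) ^ 2) = ((-(2 * b) * ∑ i, (x i) ^ 2 : ℝ) : ℂ) := by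
        push_cast; ring
      rw [this, Complex.ofReal_re]
    rw [hre]
    refine (mul_le_mul_of_nonneg_left (hC0' (expPi x)) (Real.exp_pos _).le).trans ?_
    have hE : ‖expPi x‖ ≤ Real.exp ‖x‖ := by
      refine (pi_norm_le_iff_of_nonneg (Real.exp_pos _).le).2 fun i => ?_
      rw [expPi, Real.norm_eq_abs, abs_of_pos (Real.exp_pos _)]
      exact Real.exp_le_exp.2 ((le_abs_self _).trans (by rw [← Real.norm_eq_abs]; exact norm_le_pi_norm x i))
    have hsum : ‖x‖ ^ 2 ≤ ∑ i, (x i) ^ 2 := by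
      obtain ⟨i, -, hi⟩ := Finset.exists_max_image Finset.univ (fun i => |x i|) Finset.univ_nonempty
      have hxi : ‖x‖ ≤ |x i| := (pi_norm_le_iff_of_nonneg (abs_nonneg _)).2 fun j => by
        rw [Real.norm_eq_abs]; exact hi j (Finset.mem_univ j)
      calc ‖x‖ ^ 2 ≤ |x i| ^ 2 := pow_le_pow_left₀ (norm_nonneg _) hxi 2
        _ = x i ^ 2 := sq_abs _
        _ ≤ ∑ j, x j ^ 2 := Finset.single_le_sum (f := fun j => x j ^ 2) (fun j _ => sq_nonneg _)
            (Finset.mem_univ i)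
    have h1 : Real.exp (-(2 * b) * ∑ i, x i ^ 2) ≤ Real.exp (-(2 * b) * ‖x‖ ^ 2) :=
      Real.exp_le_exp.2 (by nlinarith)
    have h2 : (1 + ‖expPi x‖) ^ N₀ ≤ (2 : ℝ) ^ N₀ * Real.exp ((N₀ : ℝ) * ‖x‖) := by
      have h3 : 1 + ‖expPi x‖ ≤ 2 * Real.exp ‖x‖ := by
        have := Real.one_le_exp (norm_nonneg x); linarith
      calc (1 + ‖expPi x‖) ^ N₀ ≤ (2 * Real.exp ‖x‖) ^ N₀ := pow_le_pow_left₀ (by positivity) h3 N₀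
        _ = (2 : ℝ) ^ N₀ * Real.exp ((N₀ : ℝ) * ‖x‖) := by
            rw [mul_pow, ← Real.exp_nat_mul]
    have h4 := exp_neg_mul_sq_mul_exp_le (by positivity : 0 < 2 * b) (N₀ : ℝ) ‖x‖
    calc Real.exp (-(2 * b) * ∑ i, x i ^ 2) * (|C₀| * (1 + ‖expPi x‖) ^ N₀)
        ≤ Real.exp (-(2 * b) * ‖x‖ ^ 2) * (|C₀| * ((2 : ℝ) ^ N₀ * Real.exp ((N₀ : ℝ) * ‖x‖))) := by gcongr
      _ = |C₀| * (2 : ℝ) ^ N₀ * (Real.exp (-(2 * b) * ‖x‖ ^ 2) * Real.exp ((N₀ : ℝ) * ‖x‖)) := by ring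
      _ ≤ |C₀| * (2 : ℝ) ^ N₀ * Real.exp ((N₀ : ℝ) ^ 2 / (4 * (2 * b))) := by gcongr
  have hdiff : ∀ ϑ : Fin (k + 1) → 𝓢(ℝ, ℂ),
      ∫ x : Fin (k + 1) → ℝ, (F (ι x) - logDensity S b x) * ∏ i, ϑ i (x i) = 0 := by
    intro ϑ
    have hi1 := Literature.Analysis.Complex.integrable_mul_prod_schwartz hFc hFb ϑ
    have hi2 := Literature.Analysis.Complex.integrable_mul_prod_schwartz (continuous_logDensity hSc) hDb ϑ
    simp_rw [sub_mul]
    rw [integral_sub hi1 hi2, ← hT ϑ, logT_gaussian_mul_eq_integral_logDensity, sub_self]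
  have h := eq_zero_of_forall_integral_mul_prod_schwartz_eq_zero (hFc.sub (continuous_logDensity hSc)) hdiff x₀
  exact sub_eq_zero.1 h

end Explicit

end Literature.MathematicalPhysics.QuantumFieldTheory.LogSlot
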